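import Summits.KontsevichZagierPeriods.KontsevichZagierPeriods.Theses.HermiteRigidity
import Summits.KontsevichZagierPeriods.KontsevichZagierPeriods.Theorems.HermiteRigidityPadeBoxIslands
import Summits.KontsevichZagierPeriods.KontsevichZagierPeriods.Theorems.HermiteRigidityReductionRigidityOfIslands

/-!
# Line skeleton v7 (FINAL SHAPE) — crux `ReductionRigidity` (stmt-KontsevichZagierPeriods-3407), line `Sketch`
# (idea `pade-box-islands`), lead `prover-line-…-3407-c4-0`

The line is DONE and absorbed by the route: its content is the route item `PadeBoxIslands`
(stmt-15909, PROVED: `Theorems/HermiteRigidityPadeBoxIslands.lean`, glue over the line's landed stubs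
`Theorems/HermiteRigidityReductionRigidity{LineBase,LineDescent,TorusExactness,EulerDescent,BoxPolynomial,
LineRigidity,LineReduction,BoxTwoReduction}.lean`), its remainder is the route crux `IslandComplement`
(stmt-15935, OPEN, = the former `stub_islandComplement` verbatim, summit-strength), and the split glue
`ReductionRigidityOfIslands : PadeBoxIslands → IslandComplement → ReductionRigidity` (stmt-15957) is PROVED
(`Theorems/HermiteRigidityReductionRigidityOfIslands.lean`). Beyond the route items the lead also landed the
every-weight / rational-level programme (`Theorems/HermiteRigidityReductionRigidity{TorusGen,EulerGen,
MonomialDivisionGen,GenReduction,PadeBoxIslandsAllWeights}.lean`: `padeBoxKernelGen w ν`,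
`padeBoxKernelGen_one_rat`).

So the skeleton has exactly ONE stub, the route decl `IslandComplement` BY NAME, and the composition is the
landed split glue fed with the landed islands.
-/

noncomputable section

namespace Summit.KontsevichZagierPeriods.HermiteRigidity.ReductionRigidity

open Summit.KontsevichZagierPeriods.KontsevichZagierPeriods.Theses.HermiteRigidity
  (ReductionRigidity PadeBoxIslands IslandComplement)

/-- STUB `islandComplement` — THE REMAINDER, now the route crux `IslandComplement`
(stmt-KontsevichZagierPeriods-15935) by name: the kernel form of Conjecture 1 given the Padé box islands.
Summit-strength (its conclusion is the kernel form = the summit, `kzKernelConjecture_iff_isRational`);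
nobody works it inside this line. -/
theorem stub_islandComplement :
    Summit.KontsevichZagierPeriods.KontsevichZagierPeriods.Theses.HermiteRigidity.IslandComplement := by
  sorry

/-- **The composition**: the crux `ReductionRigidity`, concluded BY NAME from the landed islands
(`padeBoxIslands_proof`, stmt-15909) and the remainder through the landed split glue
`reductionRigidityOfIslands_proof` (stmt-15957). [cite: KontsevichZagier2001, §1.2] -/
theorem ReductionRigidity_of :
    Summit.KontsevichZagierPeriods.KontsevichZagierPeriods.Theses.HermiteRigidity.ReductionRigidity :=
  Summit.KontsevichZagierPeriods.HermiteRigidity.ReductionRigidityOfIslands.reductionRigidityOfIslands_proof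
    Summit.KontsevichZagierPeriods.HermiteRigidity.PadeBoxIslands.padeBoxIslands_proof stub_islandComplement

end Summit.KontsevichZagierPeriods.HermiteRigidity.ReductionRigidity

end
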